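import Summits.Ventures.PercRepro.MSTightProj

/-!
# Twin classes of a set family

Two elements `a`, `b` are **twins** for a family `F` of finite sets when they lie in exactly the
same members (`Twin F a b`). Twinness is an equivalence relation; `cls F a` is the twin class of
`a` (the ambient type being finite), and a set is **twin-closed** (`TwinClosed F Z`) when it is a
union of twin classes. Members of `F`, their differences and Boolean combinations of twin-closed
sets are twin-closed.

`ClosedAdd F q` / `ClosedRem F q` say that `F` is closed under `t ↦ t ∪ q` / `t ↦ t \ q`. The two
iteration lemmas `sdiff_mem_of_forall_sdiff_cls_mem` / `union_mem_of_forall_union_cls_mem` pass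
from closure under single classes to closure under a twin-closed union of classes — the
class-level version of `sdiff_mem_of_deletable` / `union_mem_of_addable` (`MSTightClosure.lean`).
This is the bookkeeping behind the general form of Theorem S (the characterisation of equality in
Marica–Schönheim, proofs/MINE1-theoremS.md), whose induction passes through families with twins.
-/

namespace PercRepro.MSTight

open Finset
open scoped FinsetFamily symmDiff

variable {α : Type*}

/-- `a` and `b` are **twins** for `F`: they lie in exactly the same members of `F`. -/
def Twin (F : Finset (Finset α)) (a b : α) : Prop := ∀ t ∈ F, a ∈ t ↔ b ∈ t

/-- Every element is its own twin. -/
theorem twin_refl (F : Finset (Finset α)) (a : α) : Twin F a a := fun _ _ => Iff.rfl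

/-- Twinness is symmetric. -/
theorem Twin.symm {F : Finset (Finset α)} {a b : α} (h : Twin F a b) : Twin F b a :=
  fun t ht => (h t ht).symm

/-- Twinness is transitive. -/
theorem Twin.trans {F : Finset (Finset α)} {a b c : α} (h₁ : Twin F a b) (h₂ : Twin F b c) :
    Twin F a c := fun t ht => (h₁ t ht).trans (h₂ t ht)

/-- A set is **twin-closed** for `F` when it contains every twin of each of its elements. -/
def TwinClosed (F : Finset (Finset α)) (Z : Finset α) : Prop :=
  ∀ a b, Twin F a b → a ∈ Z → b ∈ Z

/-- Members of `F` are twin-closed. -/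
theorem twinClosed_of_mem {F : Finset (Finset α)} {t : Finset α} (ht : t ∈ F) :
    TwinClosed F t := fun _ _ hab ha => (hab t ht).1 ha

/-- The empty set is twin-closed. -/
theorem twinClosed_empty (F : Finset (Finset α)) : TwinClosed F ∅ :=
  fun _ _ _ h => absurd h (Finset.notMem_empty _)

/-- The whole type is twin-closed. -/
theorem twinClosed_univ [Fintype α] (F : Finset (Finset α)) : TwinClosed F Finset.univ :=
  fun _ _ _ _ => Finset.mem_univ _

variable [DecidableEq α]

/-- Twinness is decidable. -/
instance (F : Finset (Finset α)) (a b : α) : Decidable (Twin F a b) := by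
  unfold Twin; infer_instance

/-- Unions of twin-closed sets are twin-closed. -/
theorem TwinClosed.union {F : Finset (Finset α)} {Y Z : Finset α} (hY : TwinClosed F Y)
    (hZ : TwinClosed F Z) : TwinClosed F (Y ∪ Z) := by
  intro a b hab ha
  rcases Finset.mem_union.1 ha with h | h
  · exact Finset.mem_union.2 (Or.inl (hY a b hab h))
  · exact Finset.mem_union.2 (Or.inr (hZ a b hab h))

/-- Intersections of twin-closed sets are twin-closed. -/
theorem TwinClosed.inter {F : Finset (Finset α)} {Y Z : Finset α} (hY : TwinClosed F Y)
    (hZ : TwinClosed F Z) : TwinClosed F (Y ∩ Z) := by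
  intro a b hab ha
  rw [Finset.mem_inter] at ha ⊢
  exact ⟨hY a b hab ha.1, hZ a b hab ha.2⟩

/-- Differences of twin-closed sets are twin-closed. -/
theorem TwinClosed.sdiff {F : Finset (Finset α)} {Y Z : Finset α} (hY : TwinClosed F Y)
    (hZ : TwinClosed F Z) : TwinClosed F (Y \ Z) := by
  intro a b hab ha
  rw [Finset.mem_sdiff] at ha ⊢
  exact ⟨hY a b hab ha.1, fun hb => ha.2 (hZ b a hab.symm hb)⟩

/-- Symmetric differences of twin-closed sets are twin-closed. -/
theorem TwinClosed.symmDiff {F : Finset (Finset α)} {Y Z : Finset α} (hY : TwinClosed F Y)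
    (hZ : TwinClosed F Z) : TwinClosed F (Y ∆ Z) := by
  intro a b hab ha
  rw [Finset.mem_symmDiff] at ha ⊢
  rcases ha with ⟨h1, h2⟩ | ⟨h1, h2⟩
  · exact Or.inl ⟨hY a b hab h1, fun hb => h2 (hZ b a hab.symm hb)⟩
  · exact Or.inr ⟨hZ a b hab h1, fun hb => h2 (hY b a hab.symm hb)⟩

/-- Differences of members of `F` are twin-closed. -/
theorem twinClosed_of_mem_diffs {F : Finset (Finset α)} {E : Finset α} (hE : E ∈ F \\ F) :
    TwinClosed F E := by
  obtain ⟨A, hA, B, hB, rfl⟩ := Finset.mem_diffs.1 hE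
  exact (twinClosed_of_mem hA).sdiff (twinClosed_of_mem hB)

section Fintype

variable [Fintype α]

/-- The **twin class** of `a` for `F`. -/
def cls (F : Finset (Finset α)) (a : α) : Finset α := Finset.univ.filter (Twin F a)

/-- Membership in a twin class. -/
theorem mem_cls {F : Finset (Finset α)} {a b : α} : b ∈ cls F a ↔ Twin F a b := by
  simp [cls]

/-- `a` lies in its own class. -/
theorem self_mem_cls (F : Finset (Finset α)) (a : α) : a ∈ cls F a := mem_cls.2 (twin_refl F a)

/-- Twins have the same class. -/
theorem cls_eq_of_twin {F : Finset (Finset α)} {a b : α} (h : Twin F a b) : cls F a = cls F b := by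
  ext c
  simp only [mem_cls]
  exact ⟨fun h' => h.symm.trans h', fun h' => h.trans h'⟩

/-- A twin class is twin-closed. -/
theorem twinClosed_cls (F : Finset (Finset α)) (a : α) : TwinClosed F (cls F a) :=
  fun _ _ hbc hb => mem_cls.2 ((mem_cls.1 hb).trans hbc)

/-- A twin-closed set containing `a` contains its class. -/
theorem cls_subset_of_twinClosed {F : Finset (Finset α)} {Z : Finset α} (hZ : TwinClosed F Z)
    {a : α} (ha : a ∈ Z) : cls F a ⊆ Z :=
  fun _ hb => hZ a _ (mem_cls.1 hb) ha

/-- A twin-closed set meeting a class contains it. -/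
theorem cls_subset_of_twinClosed_of_mem {F : Finset (Finset α)} {Z : Finset α}
    (hZ : TwinClosed F Z) {a b : α} (hb : b ∈ cls F a) (hbZ : b ∈ Z) : cls F a ⊆ Z := by
  rw [cls_eq_of_twin (mem_cls.1 hb)]
  exact cls_subset_of_twinClosed hZ hbZ

/-- A member containing `a` contains its class. -/
theorem cls_subset_of_mem {F : Finset (Finset α)} {t : Finset α} (ht : t ∈ F) {a : α}
    (ha : a ∈ t) : cls F a ⊆ t :=
  cls_subset_of_twinClosed (twinClosed_of_mem ht) ha

/-- A member avoiding `a` avoids its class. -/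
theorem disjoint_cls_of_notMem {F : Finset (Finset α)} {t : Finset α} (ht : t ∈ F) {a : α}
    (ha : a ∉ t) : Disjoint (cls F a) t :=
  Finset.disjoint_left.2 fun _ hb hbt => ha (((mem_cls.1 hb) t ht).2 hbt)

/-- A twin-closed set avoiding `a` avoids its class. -/
theorem disjoint_cls_of_twinClosed_of_notMem {F : Finset (Finset α)} {Z : Finset α}
    (hZ : TwinClosed F Z) {a : α} (ha : a ∉ Z) : Disjoint (cls F a) Z :=
  Finset.disjoint_left.2 fun _ hb hbZ => ha (hZ _ a (mem_cls.1 hb).symm hbZ)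

/-- `F` is **closed under adding `q`**: `t ∪ q ∈ F` for every member `t`. -/
def ClosedAdd (F : Finset (Finset α)) (q : Finset α) : Prop := ∀ t ∈ F, t ∪ q ∈ F

/-- `F` is **closed under removing `q`**: `t \ q ∈ F` for every member `t`. -/
def ClosedRem (F : Finset (Finset α)) (q : Finset α) : Prop := ∀ t ∈ F, t \ q ∈ F

/-- Closure under adding is decidable. -/
instance (F : Finset (Finset α)) (q : Finset α) : Decidable (ClosedAdd F q) := by
  unfold ClosedAdd; infer_instance

/-- Closure under removing is decidable. -/
instance (F : Finset (Finset α)) (q : Finset α) : Decidable (ClosedRem F q) := by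
  unfold ClosedRem; infer_instance

/-- **Iterated removal.** If `G` is closed under removing the `P`-class of every element of a
`P`-twin-closed set `Z`, then `G` is closed under removing `Z`. -/
theorem sdiff_mem_of_forall_sdiff_cls_mem {P G : Finset (Finset α)} :
    ∀ Z : Finset α, TwinClosed P Z → (∀ a ∈ Z, ∀ t ∈ G, t \ cls P a ∈ G) →
      ∀ t ∈ G, t \ Z ∈ G := by
  intro Z
  induction Z using Finset.strongInduction with
  | H Z ih =>
    intro hZ h t ht
    rcases Z.eq_empty_or_nonempty with rfl | ⟨a, ha⟩
    · simpa using ht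
    · have hcls : cls P a ⊆ Z := cls_subset_of_twinClosed hZ ha
      have hlt : Z \ cls P a ⊂ Z := Finset.sdiff_ssubset hcls ⟨a, self_mem_cls P a⟩
      have h' : t \ cls P a ∈ G := h a ha t ht
      have := ih (Z \ cls P a) hlt (hZ.sdiff (twinClosed_cls P a))
        (fun b hb => h b (Finset.mem_sdiff.1 hb).1) _ h'
      have e : (t \ cls P a) \ (Z \ cls P a) = t \ Z := by
        ext x
        simp only [Finset.mem_sdiff]
        constructor
        · rintro ⟨⟨hx, hxa⟩, hxZ⟩
          exact ⟨hx, fun hxZ' => hxZ ⟨hxZ', hxa⟩⟩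
        · rintro ⟨hx, hxZ⟩
          exact ⟨⟨hx, fun hxa => hxZ (hcls hxa)⟩, fun h => hxZ h.1⟩
      rwa [e] at this

/-- **Iterated addition.** If `G` is closed under adding the `P`-class of every element of a
`P`-twin-closed set `Z`, then `G` is closed under adding `Z`. -/
theorem union_mem_of_forall_union_cls_mem {P G : Finset (Finset α)} :
    ∀ Z : Finset α, TwinClosed P Z → (∀ a ∈ Z, ∀ t ∈ G, t ∪ cls P a ∈ G) →
      ∀ t ∈ G, t ∪ Z ∈ G := by
  intro Z
  induction Z using Finset.strongInduction with
  | H Z ih =>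
    intro hZ h t ht
    rcases Z.eq_empty_or_nonempty with rfl | ⟨a, ha⟩
    · simpa using ht
    · have hcls : cls P a ⊆ Z := cls_subset_of_twinClosed hZ ha
      have hlt : Z \ cls P a ⊂ Z := Finset.sdiff_ssubset hcls ⟨a, self_mem_cls P a⟩
      have h' : t ∪ cls P a ∈ G := h a ha t ht
      have := ih (Z \ cls P a) hlt (hZ.sdiff (twinClosed_cls P a))
        (fun b hb => h b (Finset.mem_sdiff.1 hb).1) _ h'
      have e : t ∪ cls P a ∪ (Z \ cls P a) = t ∪ Z := by
        ext x
        simp only [Finset.mem_union, Finset.mem_sdiff]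
        constructor
        · rintro ((hx | hxa) | ⟨hxZ, _⟩)
          · exact Or.inl hx
          · exact Or.inr (hcls hxa)
          · exact Or.inr hxZ
        · rintro (hx | hxZ)
          · exact Or.inl (Or.inl hx)
          · by_cases hxa : x ∈ cls P a
            · exact Or.inl (Or.inr hxa)
            · exact Or.inr ⟨hxZ, hxa⟩
      rwa [e] at this

/-- Closure under removing a class of `F` itself, iterated over a twin-closed set. -/
theorem sdiff_mem_of_closedRem {F : Finset (Finset α)} {Z : Finset α} (hZ : TwinClosed F Z)
    (h : ∀ a ∈ Z, ClosedRem F (cls F a)) {t : Finset α} (ht : t ∈ F) : t \ Z ∈ F :=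
  sdiff_mem_of_forall_sdiff_cls_mem Z hZ (fun a ha => h a ha) t ht

/-- Closure under adding a class of `F` itself, iterated over a twin-closed set. -/
theorem union_mem_of_closedAdd {F : Finset (Finset α)} {Z : Finset α} (hZ : TwinClosed F Z)
    (h : ∀ a ∈ Z, ClosedAdd F (cls F a)) {t : Finset α} (ht : t ∈ F) : t ∪ Z ∈ F :=
  union_mem_of_forall_union_cls_mem Z hZ (fun a ha => h a ha) t ht

end Fintype

end PercRepro.MSTight
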